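import Summits.NavierStokesRegularity.FluidComputer.PalasekTowerGermHostDecorated
import Summits.NavierStokesRegularity.FluidComputer.PalasekTowerGermHostTolerant

/-!
# The germ host, XVII: the weak and tolerant slots hold a flat carrier of EVERY size

Cell `ns-blowup`, seat `ns-blowup-ecbridge-3` (g3); GROUP C «BRIDGE SUPPORT» of the route
`PalasekTowerBreakdown` (crux `EpisodeBaseG`, item stmt-NavierStokesRegularity-19179, R2 of record).
Conclusion of XVI (`PalasekTowerGermHostDecorated.lean`: the decorated blob
`decoratedBlob b a = Y₀•B_b + ½(Y₀•B_a(· − p) + Y₀•B_a(· + p))`, `p = (2b+1)e₁`, its readouts and its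
weak anchor) over ecbridge-4's weak slot / pushed germ host (p447736) and XV (tolerant slot).
LABEL: E–C typing (KERNEL: one definition with body — the decoration scale — and proofs). WHAT THIS
IS NOT: not Navier–Stokes evidence — PRESCRIBED level-`0` profiles and hosts; a lone viscous vortex
blob does not raise its speed maximum by the factor `Y₁/Y₀`, so `FirstEpisodeD` is presumably FALSE
for every member of the family; nothing about the flow after `τ₀`, `RungG 1` or blow-up.

* **`levelZeroDataWeak_decoratedBlob`**: `0 < b → 0 < a → a ≤ 5/256 → a ≤ strainConst/512 →
  LevelZeroDataWeak (decoratedBlob b a) (2b + 2)`;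
* `decorScale = min (5/256) (strainConst/512)`, **`levelZeroDataWeak_large (hb : 0 < b)`**,
  `levelZeroDataTol_large` (every `c₄ > 0`);
* **`hostPreparationD_large`**: for every `b > 0`, `c₄ ∈ (0, 1]` the pushed germ schedule of
  `U_b = decoratedBlob b decorScale` is prepared in its singleton class — the FIRST prepared hosts of
  record whose carrier is NOT small (`‖U_b‖_{L³} ∼ Y₀ b`, Reynolds number `∼ Y₀ b` at `ν = 1`);
  `episodeBaseG_of_firstEpisodeD_large`.

References: S. Palasek, arXiv:2605.13827 §3.3 [cite: Palasek2026ElementaryModel, §3.3].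
-/


noncomputable section

namespace Summit.NavierStokesRegularity.FluidComputer.PalasekTowerClayBridge.Germ

open Set Function Filter Topology InnerProductSpace Metric MeasureTheory Real
open scoped Topology ContDiff RealInnerProductSpace Laplacian

open Literature.Analysis.FluidPDE TinyBlob

section Blob

variable {a b : ℝ}

/-! ## §1 The weak and tolerant slots hold carriers of every size -/

/-- **LARGE CARRIERS IN THE WEAK SLOT**: `LevelZeroDataWeak (decoratedBlob b a) (2b + 2)` for EVERY
`b > 0` and every decoration scale `0 < a ≤ 5/256`, `a ≤ strainConst/512`. [cite: Palasek2026ElementaryModel, §3.3] -/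
theorem levelZeroDataWeak_decoratedBlob (hb : 0 < b) (ha : 0 < a) (h5 : a ≤ 5 / 256)
    (hκ : a ≤ strainConst / 512) : LevelZeroDataWeak (decoratedBlob b a) (2 * b + 2) where
  smooth := contDiff_decoratedBlob b a
  support := tsupport_decoratedBlob_subset hb ha h5
  divFree := isDivFree_decoratedBlob hb.ne' ha.ne'
  ceiling y := (norm_decoratedBlob_le hb ha h5 y).1
  floor := ⟨0, by simp; linarith, by
    rw [decoratedBlob_zero hb ha h5, norm_tinyProfile_zero]⟩
  strain := ⟨decorCenter b + a • strainPt, by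
    have := norm_add_le (decorCenter b) (a • strainPt)
    have hn : ‖a • strainPt‖ ≤ 2 * a := by
      rw [norm_smul, Real.norm_eq_abs, abs_of_pos ha]; nlinarith [norm_strainPt_le]
    rw [norm_decorCenter hb.le] at this
    linarith, strain_decoratedBlob hb ha h5 hκ⟩
  core := core_decoratedBlob hb ha h5
  anchor := anchor_decoratedBlob hb ha h5

/-- **The decoration scale of record** `a⋆ = min (5/256) (strainConst/512)`. [folklore] -/
def decorScale : ℝ := min (5 / 256) (strainConst / 512)

/-- `0 < a⋆`. [folklore] -/
theorem decorScale_pos : 0 < decorScale :=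
  lt_min (by norm_num) (div_pos strainConst_pos (by norm_num))

/-- **THE LARGE-CARRIER FAMILY** `U_b = decoratedBlob b a⋆` fills the weak slot for every `b > 0`.
[cite: Palasek2026ElementaryModel, §3.3] -/
theorem levelZeroDataWeak_large (hb : 0 < b) : LevelZeroDataWeak (decoratedBlob b decorScale) (2 * b + 2) :=
  levelZeroDataWeak_decoratedBlob hb decorScale_pos (min_le_left _ _) (min_le_right _ _)

/-- … and the tolerant slot for every push constant `c₄ > 0`. [folklore] -/
theorem levelZeroDataTol_large (hb : 0 < b) {c₄ : ℝ} (hc₄ : 0 < c₄) :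
    LevelZeroDataTol c₄ (decoratedBlob b decorScale) (2 * b + 2) :=
  (levelZeroDataWeak_large hb).tol hc₄

/-- **HOST PREPARATION FOR A CARRIER OF EVERY SIZE**: for every `b > 0` and `c₄ ∈ (0, 1]` the pushed germ
schedule of `U_b` (ecbridge-4's `LevelZeroDataWeak.schedule`) is prepared in its singleton class.
[cite: Palasek2026ElementaryModel, §3.3] -/
theorem hostPreparationD_large (hb : 0 < b) {c₄ : ℝ} (hc₄ : 0 < c₄) (hc₄' : c₄ ≤ 1) :
    HostPreparationD (HostClass.exact ((levelZeroDataWeak_large hb).schedule hc₄ hc₄')) :=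
  (levelZeroDataWeak_large hb).hostPreparationD_exact hc₄ hc₄'

/-- **The crux for `U_b`'s design reduces to its episode.** [cite: Palasek2026ElementaryModel, §4] -/
theorem episodeBaseG_of_firstEpisodeD_large (hb : 0 < b) {c₄ : ℝ} (hc₄ : 0 < c₄) (hc₄' : c₄ ≤ 1)
    (hF : FirstEpisodeD (HostClass.exact ((levelZeroDataWeak_large hb).schedule hc₄ hc₄'))) :
    EpisodeBaseG :=
  episodeBaseG_of_exact _ (hostPreparationD_large hb hc₄ hc₄') hF

end Blob

end Summit.NavierStokesRegularity.FluidComputer.PalasekTowerClayBridge.Germ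

end
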